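import Summits.NavierStokesRegularity.NavierStokesRegularity.Theorems.GaldiLiouvilleGateRecordZoomAncientStubZoomLimit
import HarnessLib

/-!
# Route `GaldiLiouvilleGate`, crux `RecordZoomAncient` (stmt-NavierStokesRegularity-0894),
  line `registered` (birth skeleton, reshape r7) — stub `stub_localZoomLimit`

**Statement.** For a classical solution `(u, p)` of the unforced Navier–Stokes system
(viscosity `ν`) on `ℝ³ × [0, T)`, Leray–Hopf from `u 0`: base times `tc n ∈ (0, T)`, centres
`xc n`, velocity levels `M n > 0` with `‖u(t, x)‖ ≤ M n` on `[0, tc n] × ℝ³`, `tc n (M n)² → ∞`,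
and the LOCAL bounds — for all `R, S > 0`, eventually in `n`, for `t ∈ [tc n − S ν/(M n)², tc n]`,
`∫_{B(xc n, R ν/M n)} |∇u(t)|² ≤ D ν M n` and `∫_{B(xc n, R ν/M n)} ‖u(t)‖⁶ ≤ D₆ (ν M n)³. Then the
velocity-normalised zooms `z n (s, y) = (M n)⁻¹ u(tc n + ν s/(M n)², xc n + (ν/M n) y)` converge
along a subsequence, pointwise on `(−∞, 0) × ℝ³`, to a bounded ancient mild solution `v`
(`ν = 1`), smooth on `(−∞, 0) × ℝ³`, with `v(s) ∈ L⁶` for all `s < 0`; and the zooms inherit the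
local bounds in their own units: for `R, S > 0`, eventually in `n`, for `s ∈ [−S, 0]`,
`∫_{B(0, R)} |∇z n(s)|² ≤ D` and `∫_{B(0, R)} ‖z n(s)‖⁶ ≤ D₆`.

**Proof (KNSS 2009, Lemma 6.1; the tree's `stub_zoomLimit` with levels `L n := ν M n`).**
Scales `α = 1/M`, `γ = ν/M`, `β = α γ = ν/M²`, viscosity `α ν/γ = 1`: each zoom is a classical
solution (`IsClassicalNSSolutionOn.stRescale`) on the window `(A n, b n)`,
`A n = −tc n (M n)²/ν → −∞`, `b n > 0`, bounded by `1` on `(A n, 0]`, with `L²`-bounded slices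
(Leray–Hopf energy bound and change of variables), hence Oseen-mild there
(`mild_of_bounded_of_eLpNorm_two_le_of_lt`); `KNSS2009_lemma61_oseenMild` extracts the
subsequence and the ancient Oseen-mild limit, a bounded ancient mild solution
(`isBoundedAncientMildSolution_of_oseen`), jointly smooth
(`HardyAncientLimit.isSmoothSpaceTimeOn_of_oseen`, KNSS 2009, Prop. 4.1). The inherited local
bounds are the change of variables `y ↦ xc n + γ y` on balls (`∇z = α γ (∇u) ∘ Φ`,
`(α γ)² γ⁻³ ν M = 1`, `α⁶ γ⁻³ (ν M)³ = 1`), valid once `S ν/(M n)² ≤ tc n` (eventually); the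
`L⁶` slices of the limit follow by Fatou on every ball `B(0, R)` along the subsequence and the
supremum over `R`.

Sources: G. Koch, N. Nadirashvili, G. Seregin, V. Šverák, Acta Math. 203 (2009), Lemma 6.1,
Prop. 4.1, §6 (6.1)–(6.3).
-/

noncomputable section

open Set MeasureTheory Filter Topology Function TopologicalSpace Literature.Analysis.FluidPDE
open scoped ENNReal NNReal InnerProductSpace RealInnerProductSpace

namespace Summit.NavierStokesRegularity.NavierStokesRegularity.Theorems.RecordZoomAncient.Birth

-- the problem-side namespace `Summit.NavierStokesRegularity.NavierStokesRegularity.…` (summit =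
-- problem for this single-problem summit) duplicates `NavierStokesRegularity` by design
set_option linter.dupNamespace false

section LocalTools

variable {E : Type*} [NormedAddCommGroup E] [InnerProductSpace ℝ E] [FiniteDimensional ℝ E]
  [MeasurableSpace E] [BorelSpace E]

omit [FiniteDimensional ℝ E] [MeasurableSpace E] [BorelSpace E] in
/-- The ball `B(0, R)` is the preimage of `B(x₀, R γ)` under `y ↦ x₀ + γ y` (`γ > 0`). [folklore] -/
theorem ball_zero_eq_preimage_space_affine {γ : ℝ} (hγ : 0 < γ) (x₀ : E) (R : ℝ) :
    Metric.ball (0 : E) R = (fun y : E => x₀ + γ • y) ⁻¹' Metric.ball x₀ (R * γ) := by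
  rw [space_affine_preimage_ball hγ, sub_self, smul_zero, mul_div_cancel_right₀ _ hγ.ne']

/-- **The Dirichlet integral of a zoomed field on a ball**: for differentiable `f : E → E` and
`γ > 0`, `∫_{B(0, R)} |∇(α f(x₀ + γ ·))|² = (α γ)² (γⁿ)⁻¹ ∫_{B(x₀, R γ)} |∇f|²` (chain rule and
`setLIntegral_preimage_comp_space_affine`). [folklore] -/
theorem setLIntegral_ball_frobeniusNormSq_fderiv_zoom {γ : ℝ} (hγ : 0 < γ) (α : ℝ) (x₀ : E)
    {f : E → E} (hf : Differentiable ℝ f) (R : ℝ) :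
    ∫⁻ y in Metric.ball 0 R,
        ENNReal.ofReal (frobeniusNormSq (fderiv ℝ (α • fun y => f (x₀ + γ • y)) y)) =
      ENNReal.ofReal ((α * γ) ^ 2) * ENNReal.ofReal (γ ^ Module.finrank ℝ E)⁻¹ *
        ∫⁻ x in Metric.ball x₀ (R * γ), ENNReal.ofReal (frobeniusNormSq (fderiv ℝ f x)) := by
  have hg : Differentiable ℝ fun y : E => f (x₀ + γ • y) :=
    hf.comp ((differentiable_const _).add (differentiable_id.const_smul γ))
  have hD : ∀ y, fderiv ℝ (α • fun y => f (x₀ + γ • y)) y =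
      (α * γ) • fderiv ℝ f (x₀ + γ • y) := by
    intro y
    rw [fderiv_const_smul (hg y)]
    have h := fderiv_comp_smul (𝕜 := ℝ) (f := fun x => f (x₀ + x)) (x := y) γ
    rw [fderiv_comp_add_left] at h
    rw [h, smul_smul]
  simp_rw [hD, frobeniusNormSq_smul, ENNReal.ofReal_mul (sq_nonneg _)]
  rw [lintegral_const_mul' _ _ ENNReal.ofReal_ne_top, ball_zero_eq_preimage_space_affine hγ x₀ R,
    setLIntegral_preimage_comp_space_affine hγ x₀
      (fun x => ENNReal.ofReal (frobeniusNormSq (fderiv ℝ f x))) (Metric.ball x₀ (R * γ)),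
    mul_assoc]

/-- **Powers of a zoomed field on a ball**: `∫_{B(0, R)} ‖α f(x₀ + γ y)‖ᵐ dy =
αᵐ (γⁿ)⁻¹ ∫_{B(x₀, R γ)} ‖f‖ᵐ` (`α ≥ 0`, `γ > 0`). [folklore] -/
theorem setLIntegral_ball_enorm_pow_zoom {F : Type*} [NormedAddCommGroup F] [NormedSpace ℝ F]
    {γ : ℝ} (hγ : 0 < γ) {α : ℝ} (hα : 0 ≤ α) (x₀ : E) (f : E → F) (R : ℝ) (m : ℕ) :
    ∫⁻ y in Metric.ball 0 R, ‖α • f (x₀ + γ • y)‖ₑ ^ m =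
      ENNReal.ofReal (α ^ m) * ENNReal.ofReal (γ ^ Module.finrank ℝ E)⁻¹ *
        ∫⁻ x in Metric.ball x₀ (R * γ), ‖f x‖ₑ ^ m := by
  simp_rw [enorm_smul, mul_pow]
  rw [lintegral_const_mul' _ _ (ENNReal.pow_ne_top enorm_ne_top), Real.enorm_eq_ofReal hα,
    ENNReal.ofReal_pow hα, ball_zero_eq_preimage_space_affine hγ x₀ R,
    setLIntegral_preimage_comp_space_affine hγ x₀ (fun x => ‖f x‖ₑ ^ m)
      (Metric.ball x₀ (R * γ)), mul_assoc]

/-- **Fatou on balls**: if measurable fields `f k` converge pointwise to `fl` and, for every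
`R > 0`, eventually `∫_{B(0, R)} ‖f k‖ᵐ dμ ≤ C`, then `∫ ‖fl‖ᵐ dμ ≤ C` (Fatou's lemma on each
ball, then the supremum over the exhausting balls `B(0, k + 1)`). [folklore] -/
theorem lintegral_enorm_pow_le_of_tendsto_of_ball_bound {Y F : Type*} [NormedAddCommGroup Y]
    [MeasurableSpace Y] [NormedAddCommGroup F] (μ : Measure Y) {f : ℕ → Y → F} {fl : Y → F}
    {C : ℝ≥0∞} (m : ℕ) (hf : ∀ k, AEStronglyMeasurable (f k) μ)
    (hconv : ∀ x, Tendsto (fun k => f k x) atTop (𝓝 (fl x)))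
    (hb : ∀ R : ℝ, 0 < R → ∀ᶠ k in atTop, ∫⁻ y in Metric.ball 0 R, ‖f k y‖ₑ ^ m ∂μ ≤ C) :
    ∫⁻ y, ‖fl y‖ₑ ^ m ∂μ ≤ C := by
  have hball : ∀ R : ℝ, 0 < R → ∫⁻ y in Metric.ball 0 R, ‖fl y‖ₑ ^ m ∂μ ≤ C := by
    intro R hR
    calc ∫⁻ y in Metric.ball 0 R, ‖fl y‖ₑ ^ m ∂μ
        = ∫⁻ y in Metric.ball 0 R, liminf (fun k => ‖f k y‖ₑ ^ m) atTop ∂μ :=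
          lintegral_congr fun y => (ENNReal.Tendsto.pow (n := m) (hconv y).enorm).liminf_eq.symm
      _ ≤ liminf (fun k => ∫⁻ y in Metric.ball 0 R, ‖f k y‖ₑ ^ m ∂μ) atTop :=
          lintegral_liminf_le' fun k => ((hf k).enorm.pow_const m).restrict
      _ ≤ C := liminf_le_of_frequently_le' (hb R hR).frequently
  rw [← setLIntegral_univ, ← Metric.iUnion_ball_nat_succ (0 : Y),
    setLIntegral_iUnion_of_directed _
      (Monotone.directed_le fun a b hab => Metric.ball_subset_ball (by simpa using hab))]
  exact iSup_le fun k => hball _ (by positivity)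

end LocalTools

/-- **S2 — `stub_localZoomLimit` (KNSS 2009, Lemma 6.1-type compactness of the
velocity-normalised zooms under local bounds; statement and proof in the module docstring).** -/
theorem stub_localZoomLimit :
    ∀ (ν T : ℝ), 0 < ν → 0 < T →
      ∀ (u : ℝ → EuclideanSpace ℝ (Fin 3) → EuclideanSpace ℝ (Fin 3)) (p : ℝ → EuclideanSpace ℝ (Fin 3) → ℝ),
        IsClassicalNSSolutionOn (Set.Ico 0 T) ν 0 u p → IsLerayHopfOn T ν 0 (u 0) u →
        ∀ (tc : ℕ → ℝ) (xc : ℕ → EuclideanSpace ℝ (Fin 3)) (M : ℕ → ℝ) (D D₆ : ℝ),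
          (∀ n, 0 < tc n ∧ tc n < T) → (∀ n, 0 < M n) →
          (∀ n, ∀ t ∈ Set.Icc 0 (tc n), ∀ x, ‖u t x‖ ≤ M n) →
          Tendsto (fun n => tc n * M n ^ 2) atTop atTop →
          (∀ R S : ℝ, 0 < R → 0 < S → ∀ᶠ n in atTop, ∀ t ∈ Set.Icc 0 (tc n), tc n - S * (ν / M n ^ 2) ≤ t →
            (∫⁻ y in Metric.ball (xc n) (R * (ν / M n)), ENNReal.ofReal (frobeniusNormSq (fderiv ℝ (u t) y))) ≤
              ENNReal.ofReal (D * (ν * M n))) →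
          (∀ R S : ℝ, 0 < R → 0 < S → ∀ᶠ n in atTop, ∀ t ∈ Set.Icc 0 (tc n), tc n - S * (ν / M n ^ 2) ≤ t →
            (∫⁻ y in Metric.ball (xc n) (R * (ν / M n)), ‖u t y‖ₑ ^ (6 : ℕ)) ≤
              ENNReal.ofReal (D₆ * (ν * M n) ^ 3)) →
          ∀ (z : ℕ → ℝ → EuclideanSpace ℝ (Fin 3) → EuclideanSpace ℝ (Fin 3)),
            (∀ n s y, z n s y = (M n)⁻¹ • u (tc n + ν / M n ^ 2 * s) (xc n + (ν / M n) • y)) →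
            ∃ (φ : ℕ → ℕ) (v : ℝ → EuclideanSpace ℝ (Fin 3) → EuclideanSpace ℝ (Fin 3)), StrictMono φ ∧
              (∀ s < 0, ∀ y, Tendsto (fun n => z (φ n) s y) atTop (𝓝 (v s y))) ∧
              IsBoundedAncientMildSolution 1 v ∧
              ContDiffOn ℝ (⊤ : ℕ∞) (Function.uncurry v) (Set.Iio 0 ×ˢ Set.univ) ∧
              (∀ s < 0, MemLp (v s) 6 volume) ∧
              (∀ R S : ℝ, 0 < R → 0 < S → ∀ᶠ n in atTop, ∀ s ∈ Set.Icc (-S) 0,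
                (∫⁻ y in Metric.ball 0 R, ENNReal.ofReal (frobeniusNormSq (fderiv ℝ (z n s) y))) ≤
                  ENNReal.ofReal D) ∧
              (∀ R S : ℝ, 0 < R → 0 < S → ∀ᶠ n in atTop, ∀ s ∈ Set.Icc (-S) 0,
                (∫⁻ y in Metric.ball 0 R, ‖z n s y‖ₑ ^ (6 : ℕ)) ≤ ENNReal.ofReal D₆) := by
  intro ν T hν _hT u p hcl hLH tc xc M D D₆ htc hM hbd hprod hE h6 z hz
  -- ### scales `α = 1/M`, `γ = ν/M`, `β = α γ = ν/M²` (viscosity `α ν/γ = 1`), windows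
  have hαpos : ∀ n, 0 < (M n)⁻¹ := fun n => inv_pos.2 (hM n)
  have hγpos : ∀ n, 0 < ν / M n := fun n => div_pos hν (hM n)
  have hβpos : ∀ n, 0 < ν / M n ^ 2 := fun n => div_pos hν (pow_pos (hM n) 2)
  obtain ⟨A, hA⟩ : ∃ A : ℕ → ℝ, ∀ n, A n = -(tc n * M n ^ 2 / ν) := ⟨_, fun n => rfl⟩
  obtain ⟨b, hb⟩ : ∃ b : ℕ → ℝ, ∀ n, b n = (T - tc n) * M n ^ 2 / ν := ⟨_, fun n => rfl⟩
  have halg : ∀ n s, ν / M n ^ 2 = (M n)⁻¹ * (ν / M n) ∧ (M n)⁻¹ * ν / (ν / M n) = 1 ∧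
      (M n)⁻¹ * M n = 1 ∧
      tc n + ν / M n ^ 2 * s = ν / M n ^ 2 * (s - A n) ∧
      T - (tc n + ν / M n ^ 2 * s) = ν / M n ^ 2 * (b n - s) ∧
      ((M n)⁻¹ * (ν / M n)) ^ 2 * ((ν / M n) ^ 3)⁻¹ * (ν * M n) = 1 ∧
      (M n)⁻¹ ^ 6 * ((ν / M n) ^ 3)⁻¹ * (ν * M n) ^ 3 = 1 := by
    intro n s
    have hMn : M n ≠ 0 := (hM n).ne'
    have hν0 : ν ≠ 0 := hν.ne'
    rw [hA n, hb n]
    refine ⟨?_, ?_, ?_, ?_, ?_, ?_, ?_⟩ <;> field_simp <;> ring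
  have hbpos : ∀ n, 0 < b n := fun n =>
    (hb n).symm ▸ div_pos (mul_pos (sub_pos.2 (htc n).2) (pow_pos (hM n) 2)) hν
  have hs_lt_b : ∀ n s, s ≤ 0 → s < b n := fun n s hs => lt_of_le_of_lt hs (hbpos n)
  -- original times of rescaled times
  have hmem_Ico : ∀ n s, A n < s → s < b n → tc n + ν / M n ^ 2 * s ∈ Ico 0 T := by
    intro n s h1 h2
    obtain ⟨-, -, -, hoA, hob, -⟩ := halg n s
    have h3 : 0 < ν / M n ^ 2 * (s - A n) := mul_pos (hβpos n) (by linarith)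
    have h4 : 0 < ν / M n ^ 2 * (b n - s) := mul_pos (hβpos n) (by linarith)
    constructor <;> linarith
  have hmem_Icc0 : ∀ n s, A n < s → s ≤ 0 → tc n + ν / M n ^ 2 * s ∈ Icc 0 (tc n) := by
    intro n s h1 h2
    obtain ⟨-, -, -, hoA, -⟩ := halg n s
    have h3 : 0 ≤ ν / M n ^ 2 * (s - A n) := mul_nonneg (hβpos n).le (by linarith)
    have h4 : ν / M n ^ 2 * s ≤ 0 := mul_nonpos_of_nonneg_of_nonpos (hβpos n).le h2
    constructor <;> linarith
  -- ### the zooms are classical solutions with viscosity `1` on `(A n, b n)`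
  have hzslice : ∀ n s, z n s =
      (M n)⁻¹ • fun y => u (tc n + ν / M n ^ 2 * s) (xc n + (ν / M n) • y) :=
    fun n s => funext fun y => hz n s y
  have hzeq : ∀ n, z n = (M n)⁻¹ • stPull (ν / M n ^ 2) (ν / M n) (tc n) (xc n) u :=
    fun n => funext fun s => funext fun y => by rw [hz n s y]; rfl
  have hclz : ∀ n, IsClassicalNSSolutionOn (Ioo (A n) (b n)) 1 0 (z n)
      ((M n)⁻¹ ^ 2 • stPull (ν / M n ^ 2) (ν / M n) (tc n) (xc n) p) := by
    intro n
    obtain ⟨hβeq, hvisc, -⟩ := halg n 0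
    have h := hcl.stRescale (hαpos n) (hγpos n) hβeq (tc n) (xc n)
    rw [smul_stPull_zero, hvisc, ← hzeq n] at h
    exact h.mono (fun s hs => hmem_Ico n s hs.1 hs.2) (uniqueDiffOn_Ioo _ _)
  have hC1z : ∀ n s, s ∈ Ioo (A n) (b n) → ContDiff ℝ 1 (z n s) := fun n s hs =>
    ((hclz n).contDiff_velocity hs).of_le (by norm_cast)
  -- ### the inputs of KNSS 2009, Lemma 6.1
  have hAlim : Tendsto A atTop atBot := by
    refine (tendsto_neg_atTop_atBot.comp (hprod.atTop_div_const hν)).congr fun n => ?_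
    rw [hA n, Function.comp_apply]
  have hcontz : ∀ n, ContinuousOn (uncurry (z n)) (Ioo (A n) 0 ×ˢ univ) := fun n =>
    (hclz n).smooth_velocity.continuousOn.mono
      (prod_mono (Ioo_subset_Ioo_right (hbpos n).le) subset_rfl)
  have hdivz : ∀ n, ∀ s ∈ Ioo (A n) 0, IsWeaklyDivFree (z n s) := fun n s hs =>
    VectorCalculus.IsDivFree.isWeaklyDivFree_holds
      ((hclz n).divFree s ⟨hs.1, hs_lt_b n s hs.2.le⟩) (hC1z n s ⟨hs.1, hs_lt_b n s hs.2.le⟩)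
  have hzb : ∀ n s, A n < s → s ≤ 0 → ∀ y, ‖z n s y‖ ≤ 1 := by
    intro n s h1 h2 y
    obtain ⟨-, -, h1eq, -⟩ := halg n s
    rw [hz n s y, norm_smul, Real.norm_of_nonneg (hαpos n).le, ← h1eq]
    exact mul_le_mul_of_nonneg_left (hbd n _ (hmem_Icc0 n s h1 h2) _) (hαpos n).le
  -- `L²` bounds of the zoom slices (Leray–Hopf energy bound and change of variables)
  obtain ⟨E2, hE2top, hE2⟩ : ∃ E2 : ℝ≥0∞, E2 ≠ ∞ ∧ ∀ t ∈ Icc 0 T, eLpNorm (u t) 2 volume ≤ E2 := by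
    refine ⟨ENNReal.ofReal (Real.sqrt (2 * VectorCalculus.kineticEnergy (u 0))),
      ENNReal.ofReal_ne_top, fun t ht => (ENNReal.pow_le_pow_left_iff two_ne_zero).1 ?_⟩
    rw [eLpNorm_two_sq_eq_lintegral, ← ENNReal.ofReal_pow (Real.sqrt_nonneg _),
      Real.sq_sqrt (mul_nonneg zero_le_two (kineticEnergy_nonneg _))]
    exact hLH.lintegral_enorm_sq_le hν.le ht
  have hKz : ∀ n, ∃ K : ℝ≥0∞, K ≠ ∞ ∧ ∀ s, A n < s → s ≤ 0 → eLpNorm (z n s) 2 volume ≤ K := by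
    intro n
    refine ⟨‖(M n)⁻¹‖ₑ *
      (ENNReal.ofReal ((ν / M n) ^ Module.finrank ℝ (EuclideanSpace ℝ (Fin 3)))⁻¹ ^
        (1 / (2 : ℝ≥0∞)).toReal * E2), ?_, fun s h1 h2 => ?_⟩
    · exact ENNReal.mul_ne_top enorm_ne_top (ENNReal.mul_ne_top
        (ENNReal.rpow_ne_top_of_nonneg ENNReal.toReal_nonneg ENNReal.ofReal_ne_top) hE2top)
    · rw [hzslice n s, eLpNorm_const_smul, eLpNorm_comp_space_affine (hγpos n) (xc n) _ 2]
      gcongr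
      exact hE2 _ ⟨(hmem_Icc0 n s h1 h2).1, (hmem_Icc0 n s h1 h2).2.trans (htc n).2.le⟩
  -- the Oseen identity of each zoom between negative times of its bounded region
  have hmildz : ∀ n, ∀ s t : ℝ, A n < s → s < t → t < 0 → ∀ x,
      z n t x = Literature.Analysis.UnboundedOperators.heatExtension (z n s) (t - s) x -
        oseenDuhamel 1 s (z n) (z n) t x := by
    intro n s t h1 h2 h3 x
    obtain ⟨K, hKtop, hK⟩ := hKz n
    exact mild_of_bounded_of_eLpNorm_two_le_of_lt (hclz n) (h1.trans (h2.trans h3)) (hbpos n)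
      (fun τ hτ y => hzb n τ hτ.1 hτ.2 y) hKtop (fun τ hτ => hK τ hτ.1 hτ.2) h1 h2 h3 x
  -- ### the inherited local bounds: `[-S, 0]` zooms into `[tc n - S β, tc n] ⊆ [0, tc n]`
  have hwin : ∀ S : ℝ, 0 < S → ∀ᶠ n in atTop, ∀ s ∈ Icc (-S) 0,
      tc n + ν / M n ^ 2 * s ∈ Icc 0 (tc n) ∧
        tc n - S * (ν / M n ^ 2) ≤ tc n + ν / M n ^ 2 * s := by
    intro S hS
    filter_upwards [hprod.eventually_ge_atTop (S * ν)] with n hn s hs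
    have h1 : S * (ν / M n ^ 2) ≤ tc n := by
      rw [← mul_div_assoc, div_le_iff₀ (pow_pos (hM n) 2)]
      exact hn
    have h2 : ν / M n ^ 2 * -S ≤ ν / M n ^ 2 * s := mul_le_mul_of_nonneg_left hs.1 (hβpos n).le
    have h3 : ν / M n ^ 2 * s ≤ 0 := mul_nonpos_of_nonneg_of_nonpos (hβpos n).le hs.2
    exact ⟨⟨by linarith, by linarith⟩, by linarith⟩
  have hlocE : ∀ R S : ℝ, 0 < R → 0 < S → ∀ᶠ n in atTop, ∀ s ∈ Icc (-S) 0,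
      (∫⁻ y in Metric.ball 0 R, ENNReal.ofReal (frobeniusNormSq (fderiv ℝ (z n s) y))) ≤
        ENNReal.ofReal D := by
    intro R S hR hS
    filter_upwards [hE R S hR hS, hwin S hS] with n hn hn' s hs
    obtain ⟨ht, hlow⟩ := hn' s hs
    have hdiff : Differentiable ℝ (u (tc n + ν / M n ^ 2 * s)) :=
      (hcl.contDiff_velocity ⟨ht.1, ht.2.trans_lt (htc n).2⟩).differentiable (by simp)
    obtain ⟨-, -, -, -, -, hid, -⟩ := halg n s
    rw [hzslice n s, setLIntegral_ball_frobeniusNormSq_fderiv_zoom (hγpos n) _ (xc n) hdiff R,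
      finrank_euclideanSpace_fin]
    calc _ ≤ ENNReal.ofReal (((M n)⁻¹ * (ν / M n)) ^ 2) * ENNReal.ofReal ((ν / M n) ^ 3)⁻¹ *
          ENNReal.ofReal (D * (ν * M n)) := by
          gcongr
          exact hn _ ht hlow
      _ = ENNReal.ofReal D := by
        rw [mul_comm D, ENNReal.ofReal_mul (mul_pos hν (hM n)).le, ← mul_assoc,
          ← ENNReal.ofReal_mul (sq_nonneg _),
          ← ENNReal.ofReal_mul (mul_nonneg (sq_nonneg _)
            (inv_nonneg.2 (pow_nonneg (hγpos n).le _))),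
          hid, ENNReal.ofReal_one, one_mul]
  have hloc6 : ∀ R S : ℝ, 0 < R → 0 < S → ∀ᶠ n in atTop, ∀ s ∈ Icc (-S) 0,
      (∫⁻ y in Metric.ball 0 R, ‖z n s y‖ₑ ^ (6 : ℕ)) ≤ ENNReal.ofReal D₆ := by
    intro R S hR hS
    filter_upwards [h6 R S hR hS, hwin S hS] with n hn hn' s hs
    obtain ⟨ht, hlow⟩ := hn' s hs
    obtain ⟨-, -, -, -, -, -, hid⟩ := halg n s
    simp_rw [hz n s]
    rw [setLIntegral_ball_enorm_pow_zoom (hγpos n) (hαpos n).le (xc n) _ R 6,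
      finrank_euclideanSpace_fin]
    calc _ ≤ ENNReal.ofReal ((M n)⁻¹ ^ 6) * ENNReal.ofReal ((ν / M n) ^ 3)⁻¹ *
          ENNReal.ofReal (D₆ * (ν * M n) ^ 3) := by
          gcongr
          exact hn _ ht hlow
      _ = ENNReal.ofReal D₆ := by
        rw [mul_comm D₆, ENNReal.ofReal_mul (pow_nonneg (mul_pos hν (hM n)).le 3), ← mul_assoc,
          ← ENNReal.ofReal_mul (pow_nonneg (hαpos n).le 6),
          ← ENNReal.ofReal_mul (mul_nonneg (pow_nonneg (hαpos n).le 6)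
            (inv_nonneg.2 (pow_nonneg (hγpos n).le _))),
          hid, ENNReal.ofReal_one, one_mul]
  -- ### KNSS 2009, Lemma 6.1: the subsequence and the ancient Oseen-mild limit
  obtain ⟨φ, W, hφ, hWc, hWdiv, hWb, hWmild, -, hpt, -⟩ :=
    KNSS2009_lemma61_oseenMild hAlim hcontz hdivz hmildz fun n τ hτ y => hzb n τ hτ.1 hτ.2.le y
  -- bounded ancient mild solution (duality form) and smoothness (KNSS 2009, Prop. 4.1)
  have hmildW : IsBoundedAncientMildSolution 1 W :=
    isBoundedAncientMildSolution_of_oseen one_pos hWc ⟨1, hWb⟩ hWdiv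
      (fun s t hst ht x => by rw [one_mul]; exact hWmild s t hst ht x)
  have hsm : IsSmoothSpaceTimeOn (Iio 0) W :=
    HardyAncientLimit.isSmoothSpaceTimeOn_of_oseen hWc zero_le_one hWb hWmild
  -- a negative time eventually lies in the windows along the subsequence
  have hev : ∀ s : ℝ, s < 0 → ∃ N : ℕ, ∀ k, s ∈ Ioo (A (φ (k + N))) (b (φ (k + N))) := by
    intro s hs
    obtain ⟨N, hN⟩ := eventually_atTop.1
      ((hAlim.comp hφ.tendsto_atTop).eventually (eventually_lt_atBot s))
    exact ⟨N, fun k => ⟨hN (k + N) (Nat.le_add_left N k), hs_lt_b _ s hs.le⟩⟩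
  refine ⟨φ, W, hφ, hpt, hmildW, hsm, fun s hs => ?_, hlocE, hloc6⟩
  -- `L⁶` slices of the limit: Fatou on balls along the subsequence, supremum over the radius
  obtain ⟨N, hN⟩ := hev s hs
  refine ⟨(hsm.contDiff_slice hs).continuous.aestronglyMeasurable,
    (eLpNorm_lt_top_iff_lintegral_rpow_enorm_lt_top (by norm_num) (by norm_num)).2 ?_⟩
  have h6W : ∫⁻ y, ‖W s y‖ₑ ^ (6 : ℕ) ≤ ENNReal.ofReal D₆ :=
    lintegral_enorm_pow_le_of_tendsto_of_ball_bound volume 6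
      (fun k => (hC1z _ s (hN k)).continuous.aestronglyMeasurable)
      (fun y => (hpt s hs y).comp (tendsto_add_atTop_nat N))
      (fun R hR => ((hφ.tendsto_atTop.comp (tendsto_add_atTop_nat N)).eventually
        (hloc6 R (-s) hR (neg_pos.2 hs))).mono fun k hk => hk s ⟨(neg_neg s).le, hs.le⟩)
  have e6 : (6 : ℝ≥0∞).toReal = ((6 : ℕ) : ℝ) := by norm_num
  simp_rw [e6, ENNReal.rpow_natCast]
  exact h6W.trans_lt ENNReal.ofReal_lt_top

end Summit.NavierStokesRegularity.NavierStokesRegularity.Theorems.RecordZoomAncient.Birth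

end
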